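import Literature.Probability.RandomPlanarGeometry.SAWRenewalRatioRate
import Literature.Probability.RandomPlanarGeometry.SAWHalfSpaceTwoStepRate
import Mathlib.Analysis.SpecialFunctions.Pow.Real
import HarnessLib

/-!
# Lawler–Schramm–Werner (A.3) with a rate: `|h_{N+1}/h_N − μ| ≤ K / log N` for half-space walks, unconditional

Topic `Literature/Probability/RandomPlanarGeometry` (assembles `SAWRenewalRatioRate.lean` — the generic one-step
ratio-rate engine `halfSpaceRatio_rate_log_of` — with `SAWHalfSpaceTwoStepRate.lean` — the two-step rate
`halfSpaceTwoStepRate`).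

Source: G. Lawler, O. Schramm, W. Werner, *On the scaling limit of planar self-avoiding walk* (2004), Appendix A
(arXiv:math/0204277 p. 18, L80–L111): (A.3) `lim υ_{n+1}/υ_n = β` for the half-space walks `υ_n = h_n`, proved
from the renewal inequality `υ_n ≥ Σ_j λ_j υ_{n−j}`, a parity split and a lim sup argument — NO RATE (the tree's
qualitative twin: `LSW2004_eqA3_of_eqA2`). Madras–Slade (1993) Theorem 7.3.4 lists ratio limits for `c_N`, `b_N`,
`c_N(0,x)` only.

## What is new in this file (not in print)

* `halfSpaceTwoStepRate_abs` — the symmetric form `|h_{N+2}/h_N − μ²| ≤ K N^{-1/4}` of the two-step rate;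
* **`halfSpaceRatio_rate_log (d) : ∃ K, ∀ N ≥ 2, |h_{N+1}/h_N − μ| ≤ K / log N`** on `ℤ^{d+2}`, unconditional;
* `halfSpaceRatio_rate_limsup` — the sharp-constant form `(2μ/(αE) + δ)/log N` eventually, `E` any odd partial sum of
  Kesten's masses (the same finite-data constant as for bridges).
(Lane «pcv-sawmu» route R27.5; typed by a-idea-1; two-step rate a-p3; engine and assembly a-p5.)
-/

noncomputable section

open Finset Filter Topology Literature.Probability.LatticeModels
open scoped BigOperators

namespace Literature.Probability.RandomPlanarGeometry.SAW.Zd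

/-- The two-step rate in symmetric form: `|h_{N+2}/h_N − μ²| ≤ K N^{-1/4}` eventually (from the asymmetric
`-K N^{-1/3} ≤ … ≤ K N^{-1/4}`, since `N^{-1/3} ≤ N^{-1/4}` for `N ≥ 1`).
[cite: LawlerSchrammWerner2004SAW, Appendix (A.2); MadrasSlade1993, §7.5 eq. (7.5.2)] -/
theorem halfSpaceTwoStepRate_abs (d : ℕ) :
    ∃ K : ℝ, ∃ N₀ : ℕ, ∀ N : ℕ, N₀ ≤ N →
      |(halfSpaceCount (d + 2) (N + 2) : ℝ) / halfSpaceCount (d + 2) N - connectiveConstant (d + 2) ^ 2| ≤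
        K * (N : ℝ) ^ (-(1 : ℝ) / 4) := by
  obtain ⟨K, N₀, h⟩ := halfSpaceTwoStepRate d
  refine ⟨max K 0, max N₀ 1, fun N hN => ?_⟩
  have hN₀ : N₀ ≤ N := le_trans (le_max_left _ _) hN
  have hN1 : 1 ≤ N := le_trans (le_max_right _ _) hN
  obtain ⟨h1, h2⟩ := h N hN₀
  have hNpos : (0 : ℝ) < N := by exact_mod_cast hN1
  have hr4 : 0 ≤ (N : ℝ) ^ (-(1 : ℝ) / 4) := Real.rpow_nonneg hNpos.le _
  have hr3 : 0 ≤ (N : ℝ) ^ (-(1 : ℝ) / 3) := Real.rpow_nonneg hNpos.le _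
  have h34 : (N : ℝ) ^ (-(1 : ℝ) / 3) ≤ (N : ℝ) ^ (-(1 : ℝ) / 4) :=
    Real.rpow_le_rpow_of_exponent_le (by exact_mod_cast hN1) (by norm_num)
  have hK : K ≤ max K 0 := le_max_left _ _
  have hK0 : 0 ≤ max K 0 := le_max_right _ _
  rw [abs_le]
  constructor
  · -- `-(max K 0) N^{-1/4} ≤ -K N^{-1/3} ≤ …`
    have : K * (N : ℝ) ^ (-(1 : ℝ) / 3) ≤ max K 0 * (N : ℝ) ^ (-(1 : ℝ) / 4) :=
      calc K * (N : ℝ) ^ (-(1 : ℝ) / 3) ≤ max K 0 * (N : ℝ) ^ (-(1 : ℝ) / 3) :=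
            mul_le_mul_of_nonneg_right hK hr3
        _ ≤ max K 0 * (N : ℝ) ^ (-(1 : ℝ) / 4) := mul_le_mul_of_nonneg_left h34 hK0
    linarith
  · exact h2.trans (mul_le_mul_of_nonneg_right hK hr4)

/-- **Lawler–Schramm–Werner (A.3) with a RATE, unconditional, every `d + 2 ≥ 2`:**
`∃ K, ∀ N ≥ 2, |h_{N+1}/h_N − μ| ≤ K / log N` for the half-space walk counts `h_N`.
[cite: LawlerSchrammWerner2004SAW, Appendix (A.3); MadrasSlade1993, Theorem 7.3.4 (d)] -/
theorem halfSpaceRatio_rate_log (d : ℕ) :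
    ∃ K : ℝ, ∀ N : ℕ, 2 ≤ N →
      |(halfSpaceCount (d + 2) (N + 1) : ℝ) / halfSpaceCount (d + 2) N - connectiveConstant (d + 2)| ≤
        K / Real.log N :=
  halfSpaceRatio_rate_log_of d (halfSpaceTwoStepRate_abs d)

/-- **(A.3) with the SHARP constant**: for every `α ∈ (0,1/4)`, `δ > 0`, `T₀ ≥ 1`, eventually
`|h_{N+1}/h_N − μ| ≤ (2μ/(αE) + δ)/log N`, `E = Σ_{t<T₀} λ_{2t+1} μ^{-(2t+1)}`.
[cite: LawlerSchrammWerner2004SAW, Appendix (A.3); MadrasSlade1993, Theorem 7.3.4 (d) (proof, eq. (7.3.14))] -/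
theorem halfSpaceRatio_rate_limsup (d T₀ : ℕ) (hT₀ : 1 ≤ T₀) {α : ℝ} (hα0 : 0 < α) (hα : α < 1 / 4)
    {δ : ℝ} (hδ : 0 < δ) :
    ∀ᶠ N : ℕ in atTop,
      |(halfSpaceCount (d + 2) (N + 1) : ℝ) / halfSpaceCount (d + 2) N - connectiveConstant (d + 2)| ≤
        (2 * connectiveConstant (d + 2) /
            (α * ∑ t ∈ range T₀, (irreducibleBridgeCount (d + 2) (2 * t + 1) : ℝ) /
              connectiveConstant (d + 2) ^ (2 * t + 1)) + δ) / Real.log N :=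
  halfSpaceRatio_rate_limsup_of d (halfSpaceTwoStepRate_abs d) T₀ hT₀ hα0 hα hδ

end Literature.Probability.RandomPlanarGeometry.SAW.Zd

end
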